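import Summits.HodgeConjecture.HodgeConjecture.Theorems.HeckePrymWeilWeilTwelvefoldsSqrtMinus7CmCurveSqrt
import Summits.HodgeConjecture.HodgeConjecture.Theorems.HeckePrymWeilWeilTwelvefoldsSqrtMinus7TorusModel
import Literature.AlgebraicGeometry.Motives.AbelianVarietyExistence
import HarnessLib

/-!
# The CM curve `ℂ/(ℤ + ℤ√-d)` with `[√-d]` and its degree-one cohomological model, for every `d ≥ 1`

Crux `WeilTwelvefoldsSqrtMinus7` (stmt-HodgeConjecture-1261), line `amnesic-secant-sheaves-split-fourteenfolds`
(lead seat c1), registered sub-goal `exists_cmCurveModel`: the glue of `exists_cmCurveSqrt` (the CM curve with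
`[√-d]` as an `AbelianVariety ℂ` endomorphism `φ`, `φ ≫ φ = -d`, acting as `z ↦ i√d·z` on the uniformisation
`ℂ → E_Λ(ℂ)`, `Λ = ℤ·1 + ℤ·i√d`, matrix `N = (0 1; -d 0)`) and `stub_torusModel` (the degree-one model of an
endomorphism acting linearly on the uniformisation): a complex elliptic curve `E` (an abelian variety of
dimension `1`, `Motives.dim_abelianVarietyOfAddHom`) with an endomorphism `φ`, `φ ≫ φ = -d·𝟙`, a RATIONAL
basis `x₀, x₁` of `H¹(E(ℂ); ℂ)` on which `φ^*` has the integer matrix `M = (0 1; -d 0)` (`φ^* xᵢ = Σⱼ Mⱼᵢ xⱼ`),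
pull-back of the `xᵢ` additive in the morphism, `x₀ ⌣ x₁ ≠ 0` spanning `H²` — the "binary CM partner
`(M_E, G_E)`" consumed by the aiming lemma of the product trick for `K = ℚ(√-d)` (van Geemen, LNM 1594, 5.3:
`B = E × E` with `K` acting by `(ι, ῑ)`), for EVERY `d ≥ 1` (the crux uses `d = 7`).
-/

noncomputable section

set_option linter.dupNamespace false

open CategoryTheory Complex
open Literature.AlgebraicGeometry Literature.AlgebraicGeometry.Motives
  Literature.AlgebraicGeometry.HodgeTheory Literature.AlgebraicTopology.SingularHomology

namespace Summit.HodgeConjecture.HodgeConjecture.Theorems.WeilTwelvefoldsSqrtMinus7.AmnesicSecantSheaves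

/-- **The CM curve `ℂ/(ℤ + ℤ√-d)` with `[√-d]` and its degree-one model, `d ≥ 1`.** There are a complex
elliptic curve `E` (`dim E = 1`), an endomorphism `φ` with `φ ≫ φ = -d·𝟙`, and a rational basis `x₀, x₁` of
`H¹(E(ℂ); ℂ)` (`ℂ`-independent, spanning) with `φ^* xᵢ = Σⱼ Mⱼᵢ xⱼ` for the integer matrix `M = (0 1; -d 0)`,
pull-back of the `xᵢ` additive in the morphism, `x₀ ⌣ x₁ ≠ 0` and `H²(E(ℂ); ℂ) = ℂ·(x₀ ⌣ x₁)`. Witness: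
`E = E_Λ`, `Λ = ℤ + ℤ·i√d`, `φ = [i√d]` (`exists_cmCurveSqrt`); model by `stub_torusModel`; dimension by
`Motives.dim_abelianVarietyOfAddHom`. [cite: vanGeemen1994HodgeAV, 5.3] [cite: SilvermanAEC2009, Thm. VI.4.1 (b)] -/
theorem exists_cmCurveModel (d : ℕ) (hd : 0 < d) :
    ∃ (E : AbelianVariety ℂ) (φ : E ⟶ E) (x : Fin 2 → complexBetti E.X 1),
      E.dim = 1 ∧ φ ≫ φ = -((d : ℤ) • 𝟙 E) ∧
      (∀ i, IsRationalClass (x i)) ∧ LinearIndependent ℂ x ∧ Submodule.span ℂ (Set.range x) = ⊤ ∧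
      (∀ i, complexBetti.map φ.hom.hom.hom 1 (x i) =
        ∑ j, (((!![0, 1; -(d : ℤ), 0] : Matrix (Fin 2) (Fin 2) ℤ) j i : ℤ) : ℂ) • x j) ∧
      (∀ (T : AbelianVariety ℂ) (f g : T ⟶ E) (i : Fin 2),
        complexBetti.map (f + g).hom.hom.hom 1 (x i) =
          complexBetti.map f.hom.hom.hom 1 (x i) + complexBetti.map g.hom.hom.hom 1 (x i)) ∧
      cupProduct (rfl : 1 + 1 = 2) (x 0) (x 1) ≠ 0 ∧
      (∀ c : complexBetti E.X 2, ∃ t : ℂ, c = t • cupProduct (rfl : 1 + 1 = 2) (x 0) (x 1)) := by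
  obtain ⟨L, w, N, φ, _hw, _hL1, _hL2, hN, h1, h2, hφφ, hact⟩ := exists_cmCurveSqrt d hd
  obtain ⟨x, hxr, hxi, hxs, hNx, hadd, hω, hH2⟩ := stub_torusModel L w N φ h1 h2 hact
  subst hN
  exact ⟨_, φ, x, dim_abelianVarietyOfAddHom _ _ _ _ _, hφφ, hxr, hxi, hxs, hNx, hadd, hω, hH2⟩

end Summit.HodgeConjecture.HodgeConjecture.Theorems.WeilTwelvefoldsSqrtMinus7.AmnesicSecantSheaves

end
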